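import Mathlib.Algebra.MvPolynomial.CommRing
import Mathlib.RingTheory.MvPolynomial.Basic
import Mathlib.Algebra.CharP.Lemmas
import Mathlib.Data.ZMod.Basic
import Mathlib.Tactic.LinearCombination
import HarnessLib

/-!
# The `p = 3` straightening `f♮ := f − (2c)⁻¹ θ′ y²` (engine 1, T93; instrument for the `W(f)` toy model — NOT a resolution theorem)

Engine 1 of the RESOLUTION OBSERVATORY toy model `W(f)` (weighted-centre invariant in characteristic `p`), RE-DERIVATION-eng1-g41
§3.7.6 / CARVER-NOTES-eng1-g41 T93 (verdict GO from the second seat, CARVER-NOTES-eng1-g42 §1): "in `k[σ][f, y, z, …]` with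
`char k = 3` and `c ≠ 0`, if `Φ(f) = f + σ(A + θ′·y·z) + σ²B + σ³D`, `Φ(y) = y + cσz`, `Φ(z) = z`, then for `f♮ := f − (2c)⁻¹θ′y²`:
`Φ(f♮) = f♮ + σA + σ²(B + cθ′z²) + σ³D`" — the one place where `p = 3` enters PROPOSITION B″₃.

In characteristic `3`, `−(2c)⁻¹ = c⁻¹`, so `f♮ = f + c′θ′y²` with `c c′ = 1`; the statement is then a polynomial identity using
exactly `3 = 0` and `c c′ = 1`.  We type it (ours, bookkeeping):

* `straighten_identity` — the ring identity in any commutative ring of characteristic `3`;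
* `map_straighten` — the form with a ring endomorphism `Φ` fixing the scalar `c′θ′` (covers both tree models, `Φ` an
  `R`-algebra endomorphism of `MvPolynomial ι R` with `σ ∈ R = k[σ]`, and `Φ` a ring endomorphism of `(MvPolynomial ι k)[σ]`);
* `aeval_straighten` — the `MvPolynomial` instance with named slots `f, y, z`.

VALUE: bookkeeping for a toy model (Resolution Observatory cell `pub-rosobs`, carver lane gen 62; AI-written Lean; AI review is weaker
than expert review); NOT a statement about the invariant of [AbramovichTemkinWlodarczyk2024] and NOT progress on the summit.  Frame:
coordinate changes `y ↦ y + q` in positive characteristic [Hauser2010, §D (p. 12)], polynomial substitutions [Lang2002, Ch. IV §1].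
-/

namespace Literature.AlgebraicGeometry.Resolution.WeightedBlowup

namespace StraightenP3

/-- (ours, bookkeeping) **T93 as a ring identity.** In characteristic `3`, with `c c′ = 1`:
`F = f + σ(A + θ′yz) + σ²B + σ³D` and `Y = y + cσz` give `F + c′θ′Y² = (f + c′θ′y²) + σA + σ²(B + cθ′z²) + σ³D`.
[cite: Hauser2010, §D (p. 12)] [cite: Lang2002, Ch. IV §1] -/
theorem straighten_identity {S : Type*} [CommRing S] [CharP S 3] {c c' : S} (hc : c * c' = 1)
    (σ θ' f y z A B D F Y : S) (hF : F = f + σ * (A + θ' * y * z) + σ ^ 2 * B + σ ^ 3 * D) (hY : Y = y + c * σ * z) :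
    F + c' * θ' * Y ^ 2 = (f + c' * θ' * y ^ 2) + σ * A + σ ^ 2 * (B + c * θ' * z ^ 2) + σ ^ 3 * D := by
  have h3 : (3 : S) = 0 := by simpa using CharP.cast_eq_zero S 3
  rw [hF, hY]
  linear_combination (2 * σ * θ' * y * z + σ ^ 2 * θ' * c * z ^ 2) * hc + (σ * θ' * y * z) * h3

/-- (ours, bookkeeping) **T93 with the substitution.** For a ring endomorphism `Φ` fixing the scalar `c′θ′`, `Φ f = f + σ(A + θ′yz) + σ²B + σ³D`
and `Φ y = y + cσz` give `Φ (f + c′θ′y²) = (f + c′θ′y²) + σA + σ²(B + cθ′z²) + σ³D` (characteristic `3`, `c c′ = 1`).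
[cite: Hauser2010, §D (p. 12)] [cite: Lang2002, Ch. IV §1] -/
theorem map_straighten {S : Type*} [CommRing S] [CharP S 3] (Φ : S →+* S) {c c' : S} (hc : c * c' = 1) (σ θ' f y z A B D : S)
    (hκ : Φ (c' * θ') = c' * θ') (hf : Φ f = f + σ * (A + θ' * y * z) + σ ^ 2 * B + σ ^ 3 * D) (hy : Φ y = y + c * σ * z) :
    Φ (f + c' * θ' * y ^ 2) = (f + c' * θ' * y ^ 2) + σ * A + σ ^ 2 * (B + c * θ' * z ^ 2) + σ ^ 3 * D := by
  rw [map_add, map_mul, map_pow, hκ]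
  exact straighten_identity hc σ θ' f y z A B D _ _ hf hy

open MvPolynomial in
/-- (ours, bookkeeping) **T93 in the slot model.** `R` a commutative ring of characteristic `3` (in use: `R = k[σ]`, `σ ∈ R`), slots `f, y, z : ι`,
`Φ` an `R`-algebra endomorphism of `R[X_ι]` with `Φ X_f = X_f + σ(A + θ′X_yX_z) + σ²B + σ³D` and `Φ X_y = X_y + cσX_z`; then
`Φ (X_f + c′θ′X_y²) = (X_f + c′θ′X_y²) + σA + σ²(B + cθ′X_z²) + σ³D`. [cite: Hauser2010, §D (p. 12)] [cite: Lang2002, Ch. IV §1] -/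
theorem aeval_straighten {R : Type*} [CommRing R] [CharP R 3] {ι : Type*} (Φ : MvPolynomial ι R →ₐ[R] MvPolynomial ι R)
    {c c' : R} (hc : c * c' = 1) (σ θ' : R) (f y z : ι) (A B D : MvPolynomial ι R)
    (hf : Φ (X f) = X f + C σ * (A + C θ' * X y * X z) + C σ ^ 2 * B + C σ ^ 3 * D)
    (hy : Φ (X y) = X y + C c * C σ * X z) :
    Φ (X f + C c' * C θ' * X y ^ 2)
      = (X f + C c' * C θ' * X y ^ 2) + C σ * A + C σ ^ 2 * (B + C c * C θ' * X z ^ 2) + C σ ^ 3 * D := by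
  have hC : ∀ r : R, Φ (C r) = C r := fun r => by
    rw [← MvPolynomial.algebraMap_eq]
    exact Φ.commutes r
  have hcC : C c * C c' = (1 : MvPolynomial ι R) := by rw [← C_mul, hc, C_1]
  exact map_straighten (Φ : MvPolynomial ι R →+* MvPolynomial ι R) hcC (C σ) (C θ') (X f) (X y) (X z) A B D
    (by rw [RingHom.coe_coe, map_mul, hC, hC]) (by rw [RingHom.coe_coe, hf]) (by rw [RingHom.coe_coe, hy])

/-! ## Smoke test -/

/-- Smoke test (ours): the identity with all data `= 1` in `ZMod 3` (`c = c′ = 1`): `F = 1 + (1+1) + 1 + 1`, `Y = 1 + 1`. -/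
example : ((1 + 1 * ((1 : ZMod 3) + 1 * 1 * 1) + 1 ^ 2 * 1 + 1 ^ 3 * 1) : ZMod 3) + 1 * 1 * (1 + 1 * 1 * 1) ^ 2
    = (1 + 1 * 1 * 1 ^ 2) + 1 * 1 + 1 ^ 2 * (1 + 1 * 1 * 1 ^ 2) + 1 ^ 3 * 1 :=
  straighten_identity (S := ZMod 3) (c := 1) (c' := 1) (one_mul 1) 1 1 1 1 1 1 1 1 _ _ rfl rfl

end StraightenP3

end Literature.AlgebraicGeometry.Resolution.WeightedBlowup
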